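import Literature.AlgebraicGeometry.HodgeTheory.DworkSexticEquivariantTransport
import Literature.AlgebraicGeometry.HodgeTheory.DworkSexticFlatPiecesPurityOfTransport
import Literature.AlgebraicGeometry.HodgeTheory.DirectImageConjugation
import HarnessLib

/-!
# The transport along the Dwork line is real, multiplicative and fixes the ambient classes;
# purity of the flat pieces of types `(1,2,3,3,4,5)`, `(1,1,2,4,5,5)`, `(1,1,3,3,5,5)` modulo the
# character of `H^{4,0}`

Family `hodge`, layer `Literature/AlgebraicGeometry/HodgeTheory`; theorems only (no definition, no named
fact; D-0026). Sequel to `DworkSexticEquivariantTransport` (the injective `Γ_W`-equivariant transport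
`T : H⁴(X_ψ(ℂ); ℂ) → H⁴(X⁴₆(ℂ); ℂ)`, `ψ⁶ ≠ 1`) and `DworkSexticFlatPiecesPurityOfTransport` (purity of the
flat pieces along such a `T` which moreover commutes with conjugation, is multiplicative into `H⁸` through a
companion `T'`, and fixes the restricted ambient classes). Written for crux K2
`FlatClassesSpannedByReflectionInvariants` (stmt-HodgeConjecture-20241) of route
`HodgeConjecture/DworkReflectionQuotients`.

* `DworkSextic.exists_transportData_of_family` — for a `Γ_W`-family through `X_ψ` and `X⁴₆` as in
  `exists_equivariant_transport_of_family`, which in addition maps to `ℙ⁵` compatibly with the embeddings of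
  the two fibres, the transports `T = (e₂⁻¹)^* ∘ γ_* ∘ e₁^*` on `H⁴` and `T'` on `H⁸` are injective,
  `Γ_W`-equivariant, commute with complex conjugation (`transportFun_conjClass`), satisfy
  `T'(x ⌣ y) = Tx ⌣ Ty` (`transportFun_cupProduct`) and `T(ι_ψ^* θ) = ι_0^* θ` for `θ ∈ H⁴(ℙ⁵(ℂ); ℂ)`
  (restrictions of global classes are flat, `transportFun_map_fiberι`) — Voisin II §3.1.2.
* `DworkSextic.exists_transportData` — **these data exist for every `ψ⁶ ≠ 1`**, by the construction of
  `DworkSexticEquivariantTransport` (the family of `Γ_W`-invariant nonsingular sextics with its relative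
  diagonal automorphisms and its map to `ℙ⁵`).
* `DworkSextic.flatTypes_pullback_mem_hodgePQ_two_two_of_topCharacter`,
  `DworkSextic.flatClasses_mem_span_reflInvariant_of_topCharacter` — **Katz's Lemma 3.1(2) and the body of
  crux K2 for the flat types `j = 0, 2, 3` (810 of 1170 classes), granted ONLY that `H^{4,0}(X_ψ)` carries
  the trivial character of `Γ_W`** (i.e. its eigenclasses of non-trivial character vanish; for the
  Calabi–Yau sextic `H^{4,0} = ℂ·Res(Ω/F_ψ)` — Griffiths' residues at pole order one, not proved here).

## References

* [Katz2009] N. M. Katz, Another look at the Dwork family, Progr. Math. 270 (2009), §3, Lemma 3.1.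
* [VoisinHodgeII2003] C. Voisin, Hodge Theory and Complex Algebraic Geometry II (2003), §3.1.2, §6.2.1.
* [VoisinHodgeI2002] C. Voisin, Hodge Theory and Complex Algebraic Geometry I (2002), §6.3.2 Thm. 6.32,
  §9.2.1.
* [BiniGarbagnati2012] G. Bini, A. Garbagnati, Quotients of the Dwork pencil, J. Geom. Phys. 75 (2014), §3.4.
-/

noncomputable section

open CategoryTheory MvPolynomial Finset
open scoped BigOperators

namespace Literature.AlgebraicGeometry.HodgeTheory.DworkSextic

open Literature.AlgebraicGeometry.Motives Literature.AlgebraicTopology.SingularHomology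
open Literature.AlgebraicGeometry.Motives.UniversalHypersurface
open Literature.AlgebraicGeometry.HodgeTheory.UniversalHypersurface

/-! ### Transport data from a `Γ_W`-family mapping to `ℙ⁵` -/

section Family

variable {𝒳 S : SchemeOver ℂ} (π : 𝒳 ⟶ S) {U : Set (ComplexPoints S)}
  (hU : IsCohomologicallyLocallyTrivialOn π U) {s₁ s₂ : U} (γ : Path.Homotopic.Quotient s₁ s₂)
  (G : gammaW → (𝒳 ⟶ 𝒳)) (hG : ∀ a, G a ≫ π = π)
  (gf : ∀ (a : gammaW) (t : ComplexPoints S), fiberOver π t ⟶ fiberOver π t)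
  (hgf : ∀ a t, gf a t ≫ fiberι π t = fiberι π t ≫ G a)
  {ψ : ℂ} (e₁ : fiberOver π s₁.1 ≅ fibre ψ) (e₂ : fiberOver π s₂.1 ≅ fermatHypersurface 4 6)
  (he₁ : ∀ a : gammaW,
    gf a s₁.1 ≫ e₁.hom = e₁.hom ≫ diagonalAut (form ψ) (gammaW_le_diagonalStabilizer ψ a.2))
  (he₂ : ∀ a : gammaW,
    gf a s₂.1 ≫ e₂.hom = e₂.hom ≫ diagonalAut (fermatPolynomial ℂ 4 6) (gammaW_le_diagonalStabilizer_fermat a.2))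
  (P5 : 𝒳 ⟶ projectiveSpace (4 + 1) ℂ)
  (hP₁ : fiberι π s₁.1 ≫ P5 = e₁.hom ≫ SmoothHypersurface.hypersurfaceι (form ψ))
  (hP₂ : fiberι π s₂.1 ≫ P5 = e₂.hom ≫ SmoothHypersurface.hypersurfaceι (fermatPolynomial ℂ 4 6))

include hU γ hG hgf he₁ he₂ hP₁ hP₂ in
/-- **Transport data from a `Γ_W`-family mapping to `ℙ⁵`.** Under the hypotheses of
`exists_equivariant_transport_of_family` and with a morphism `P5 : 𝒳 ⟶ ℙ⁵` restricting on the two fibres to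
the embeddings of `X_ψ` and `X⁴₆`, the transports `T` (degree `4`) and `T'` (degree `8`) along `γ`,
conjugated by the fibre isomorphisms, are: injective and `Γ_W`-equivariant (`T`), real
(`T ∘ conj = conj ∘ T`), multiplicative (`T'(x ⌣ y) = Tx ⌣ Ty`), and `T(ι_ψ^* θ) = ι_0^* θ` for every
ambient class `θ ∈ H⁴(ℙ⁵(ℂ); ℂ)`. [cite: VoisinHodgeII2003, §3.1.2] [cite: Katz2009, §3 p. 92] -/
theorem exists_transportData_of_family :
    ∃ (T : complexBetti (fibre ψ) (2 * 2) →ₗ[ℂ] complexBetti (fermatHypersurface 4 6) (2 * 2))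
      (T' : complexBetti (fibre ψ) (2 * 4) →ₗ[ℂ] complexBetti (fermatHypersurface 4 6) (2 * 4)),
      Function.Injective T ∧
      (∀ (a : gammaW) (c : complexBetti (fibre ψ) (2 * 2)),
        T (singularCohomology.map ℂ ℂ (diagonalMap (form ψ) (gammaW_le_diagonalStabilizer ψ a.2)) (2 * 2) c) =
          singularCohomology.map ℂ ℂ
            (diagonalMap (fermatPolynomial ℂ 4 6) (gammaW_le_diagonalStabilizer_fermat a.2)) (2 * 2) (T c)) ∧
      (∀ c, T (conjClass _ (2 * 2) c) = conjClass _ (2 * 2) (T c)) ∧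
      (∀ x y : complexBetti (fibre ψ) (2 * 2),
        T' (cupProduct (by norm_num : 2 * 2 + 2 * 2 = 2 * 4) x y) =
          cupProduct (by norm_num : 2 * 2 + 2 * 2 = 2 * 4) (T x) (T y)) ∧
      (∀ θ : complexBetti (projectiveSpace (4 + 1) ℂ) (2 * 2),
        T (complexBetti.map (SmoothHypersurface.hypersurfaceι (form ψ)) (2 * 2) θ) =
          complexBetti.map (SmoothHypersurface.hypersurfaceι (fermatPolynomial ℂ 4 6)) (2 * 2) θ) := by
  -- the transports conjugated by the fibre isomorphisms (same formula as `exists_equivariant_transport_of_family`)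
  let T₀ : ∀ k : ℕ, complexBetti (fibre ψ) k →ₗ[ℂ] complexBetti (fermatHypersurface 4 6) k := fun k =>
    (complexBetti.map e₂.inv k).hom ∘ₗ transportLinear π k hU γ ∘ₗ (complexBetti.map e₁.hom k).hom
  have hT₀ : ∀ (k : ℕ) (c : complexBetti (fibre ψ) k),
      T₀ k c = complexBetti.map e₂.inv k (transportFun π k hU γ (complexBetti.map e₁.hom k c)) := fun k c => rfl
  -- injectivity (each factor has a left inverse)
  have hinj : Function.Injective (T₀ (2 * 2)) := by
    have h₁ : Function.Injective (complexBetti.map e₁.hom (2 * 2)) := fun x y hxy => by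
      have h := congrArg (complexBetti.map e₁.inv (2 * 2)) hxy
      rwa [← complexBetti.map_comp_apply', ← complexBetti.map_comp_apply', e₁.inv_hom_id,
        complexBetti.map_id] at h
    have h₂ : Function.Injective (transportFun π (2 * 2) hU γ) := fun x y hxy => by
      have h := congrArg (transportFun π (2 * 2) hU γ.symm) hxy
      rwa [← transportFun_trans, ← transportFun_trans, Path.Homotopic.Quotient.trans_symm,
        transportFun_refl, transportFun_refl] at h
    have h₃ : Function.Injective (complexBetti.map e₂.inv (2 * 2)) := fun x y hxy => by
      have h := congrArg (complexBetti.map e₂.hom (2 * 2)) hxy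
      rwa [← complexBetti.map_comp_apply', ← complexBetti.map_comp_apply', e₂.hom_inv_id,
        complexBetti.map_id] at h
    intro x y hxy
    rw [hT₀, hT₀] at hxy
    exact h₁ (h₂ (h₃ hxy))
  -- equivariance
  have hequiv : ∀ (a : gammaW) (c : complexBetti (fibre ψ) (2 * 2)),
      T₀ (2 * 2) (singularCohomology.map ℂ ℂ (diagonalMap (form ψ) (gammaW_le_diagonalStabilizer ψ a.2)) (2 * 2) c) =
        singularCohomology.map ℂ ℂ
          (diagonalMap (fermatPolynomial ℂ 4 6) (gammaW_le_diagonalStabilizer_fermat a.2)) (2 * 2) (T₀ (2 * 2) c) := by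
    intro a c
    rw [hT₀, hT₀]
    have hψ' : singularCohomology.map ℂ ℂ (diagonalMap (form ψ) (gammaW_le_diagonalStabilizer ψ a.2))
        (2 * 2) c = complexBetti.map (diagonalAut (form ψ) (gammaW_le_diagonalStabilizer ψ a.2)) (2 * 2) c :=
      rfl
    have hF' : ∀ y, singularCohomology.map ℂ ℂ
        (diagonalMap (fermatPolynomial ℂ 4 6) (gammaW_le_diagonalStabilizer_fermat a.2)) (2 * 2) y =
          complexBetti.map (diagonalAut (fermatPolynomial ℂ 4 6) (gammaW_le_diagonalStabilizer_fermat a.2))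
            (2 * 2) y := fun _ => rfl
    have hcomm : e₂.inv ≫ gf a s₂.1 =
        diagonalAut (fermatPolynomial ℂ 4 6) (gammaW_le_diagonalStabilizer_fermat a.2) ≫ e₂.inv := by
      rw [Iso.inv_comp_eq, ← Category.assoc, ← he₂ a, Category.assoc, Iso.hom_inv_id, Category.comp_id]
    rw [hψ', hF', ← complexBetti.map_comp_apply', ← he₁ a, complexBetti.map_comp_apply',
      transportFun_map_fiberHom π (2 * 2) hU (G a) (hG a) (gf a) (hgf a) γ,
      ← complexBetti.map_comp_apply', ← complexBetti.map_comp_apply', hcomm]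
  refine ⟨T₀ (2 * 2), T₀ (2 * 4), hinj, hequiv, fun c => ?_, fun x y => ?_, fun θ => ?_⟩
  · -- reality
    rw [hT₀, hT₀]
    change complexBetti.map e₂.inv (2 * 2) (transportFun π (2 * 2) hU γ
        (singularCohomology.map ℂ ℂ _ (2 * 2) (conjClass _ (2 * 2) c))) =
      conjClass _ (2 * 2) (singularCohomology.map ℂ ℂ _ (2 * 2) _)
    rw [← conjClass_map, transportFun_conjClass, conjClass_map]
  · -- multiplicativity
    rw [hT₀, hT₀, hT₀]
    change complexBetti.map e₂.inv (2 * 4) (transportFun π (2 * 4) hU γ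
        (singularCohomology.map ℂ ℂ _ (2 * 4) (cupProduct _ x y))) =
      cupProduct _ (singularCohomology.map ℂ ℂ _ (2 * 2) _) (singularCohomology.map ℂ ℂ _ (2 * 2) _)
    rw [cupProduct_map, transportFun_cupProduct, ← cupProduct_map]
  · -- ambient classes are flat
    rw [hT₀, ← complexBetti.map_comp_apply', ← hP₁, complexBetti.map_comp_apply',
      transportFun_map_fiberι π (2 * 2) hU γ, ← complexBetti.map_comp_apply' (fiberι π s₂.1) P5, hP₂,
      complexBetti.map_comp_apply' e₂.hom, ← complexBetti.map_comp_apply' e₂.inv e₂.hom, e₂.inv_hom_id,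
      complexBetti.map_id]
    rfl

end Family

/-! ### The data exist along the Dwork line -/

variable {ψ : ℂ}

/-- Fibre isomorphisms of the `M`-supported family over the point of a form `G`, typed against `X_G`
and compatible with the embeddings (as in `DworkSexticEquivariantTransport`). [cite: VoisinHodgeII2003, §6.2.1] -/
private theorem exists_fiberIso_of_eq' {M : Set (DegIndex 4 6)} (t : AlgPoints (baseM ℂ 4 6 M) ℂ)
    {G : MvPolynomial (Fin (4 + 2)) ℂ} (hG : pointFormM ℂ 4 6 M t = G) :
    ∃ e : fiberOver (familyM ℂ 4 6 M) t ≅ SmoothHypersurface.hypersurface G,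
      e.hom ≫ SmoothHypersurface.hypersurfaceι G = fiberToProjectiveSpace ℂ 4 6 M t := by
  subst hG
  exact exists_fiberIsoM_comp_hypersurfaceι ℂ 4 6 M (by norm_num) t

/-- **Transport data along the Dwork line exist** (`ψ⁶ ≠ 1`): an injective `Γ_W`-equivariant real
`T : H⁴(X_ψ(ℂ); ℂ) → H⁴(X⁴₆(ℂ); ℂ)` with a multiplicative companion `T'` on `H⁸` and `T ∘ ι_ψ^* = ι_0^*` on
`H⁴(ℙ⁵(ℂ); ℂ)` — the construction of `exists_equivariant_transport` (the family of `Γ_W`-invariant nonsingular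
sextics, a path from `F_ψ` to `Σ xᵢ⁶`), read through `exists_transportData_of_family` with the family's map
to `ℙ⁵`. [cite: Katz2009, §3 p. 92 and Lemma 3.1(1)] [cite: VoisinHodgeII2003, §3.1.2 and §6.2.1] -/
theorem exists_transportData (hψ : ψ ^ 6 ≠ 1) :
    ∃ (T : complexBetti (fibre ψ) (2 * 2) →ₗ[ℂ] complexBetti (fermatHypersurface 4 6) (2 * 2))
      (T' : complexBetti (fibre ψ) (2 * 4) →ₗ[ℂ] complexBetti (fermatHypersurface 4 6) (2 * 4)),
      Function.Injective T ∧
      (∀ (a : gammaW) (c : complexBetti (fibre ψ) (2 * 2)),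
        T (singularCohomology.map ℂ ℂ (diagonalMap (form ψ) (gammaW_le_diagonalStabilizer ψ a.2)) (2 * 2) c) =
          singularCohomology.map ℂ ℂ
            (diagonalMap (fermatPolynomial ℂ 4 6) (gammaW_le_diagonalStabilizer_fermat a.2)) (2 * 2) (T c)) ∧
      (∀ c, T (conjClass _ (2 * 2) c) = conjClass _ (2 * 2) (T c)) ∧
      (∀ x y : complexBetti (fibre ψ) (2 * 2),
        T' (cupProduct (by norm_num : 2 * 2 + 2 * 2 = 2 * 4) x y) =
          cupProduct (by norm_num : 2 * 2 + 2 * 2 = 2 * 4) (T x) (T y)) ∧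
      (∀ θ : complexBetti (projectiveSpace (4 + 1) ℂ) (2 * 2),
        T (complexBetti.map (SmoothHypersurface.hypersurfaceι (form ψ)) (2 * 2) θ) =
          complexBetti.map (SmoothHypersurface.hypersurfaceι (fermatPolynomial ℂ 4 6)) (2 * 2) θ) := by
  -- the family of `Γ_W`-invariant nonsingular sextics (as in `exists_equivariant_transport`)
  set M : Set (DegIndex 4 6) := {m | ∀ a : gammaW, unitWeight ℂ 4 (a : Fin (4 + 2) → ℂˣ) m.1 = 1} with hM
  have hfix : ∀ a : gammaW, FixesMonomials ℂ 4 6 M (a : Fin (4 + 2) → ℂˣ) := fun a m hm => hm a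
  set t₁ : AlgPoints (baseM ℂ 4 6 M) ℂ :=
    pointOfFormM ℂ 4 6 M (isHomogeneous_form ψ) (isNonsingularForm_form hψ) (isSupportedOn_form ψ) with ht₁
  set t₂ : AlgPoints (baseM ℂ 4 6 M) ℂ :=
    pointOfFormM ℂ 4 6 M (isHomogeneous_fermatPolynomial 4 6) isNonsingularForm_fermat isSupportedOn_fermat
    with ht₂
  obtain ⟨c, hc⟩ : ∃ c : Path ψ 0, ∀ t, (c t) ^ 6 ≠ 1 := by
    have hfin : ({z : ℂ | z ^ 6 = 1}).Finite := by
      refine (Polynomial.nthRoots 6 (1 : ℂ)).toFinset.finite_toSet.subset fun z hz => ?_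
      simp only [Set.mem_setOf_eq] at hz
      simp [Multiset.mem_toFinset, Polynomial.mem_nthRoots, hz]
    have hpc : IsPathConnected ({z : ℂ | z ^ 6 = 1}ᶜ) :=
      hfin.countable.isPathConnected_compl_of_one_lt_rank (by rw [Complex.rank_real_complex]; norm_num)
    obtain ⟨c, hc⟩ := hpc.joinedIn ψ hψ 0 (by simp)
    exact ⟨c, fun t => hc t⟩
  have hcoeff : Continuous fun z : ℂ => fun m : DegIndex 4 6 => coeff m.1 (form z) := by
    refine continuous_pi fun m => ?_
    have h : ∀ z : ℂ, coeff m.1 (form z) =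
        coeff m.1 (∑ i : Fin 6, (X i : MvPolynomial (Fin 6) ℂ) ^ 6) -
          (6 * z) * coeff m.1 (∏ i : Fin 6, (X i : MvPolynomial (Fin 6) ℂ)) := fun z => by
      rw [form, coeff_sub, coeff_C_mul]
    simp_rw [h]
    fun_prop
  have hJ : ∀ t, SmoothHypersurface.IsNonsingularForm ℂ
      (formOfCoeffs (fun m : DegIndex 4 6 => coeff m.1 (form (c t)))) := fun t => by
    rw [formOfCoeffs_coeff _ (isHomogeneous_form (c t))]
    exact isNonsingularForm_form (hc t)
  have hcont : Continuous fun t => pointOfCoeffs ℂ 4 6 (fun m : DegIndex 4 6 => coeff m.1 (form (c t))) (hJ t) :=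
    continuous_pointOfCoeffs_comp ℂ 4 6 (hcoeff.comp c.continuous) hJ
  have hends : ∀ {G : MvPolynomial (Fin (4 + 2)) ℂ} (hG : G.IsHomogeneous 6)
      (hGJ : SmoothHypersurface.IsNonsingularForm ℂ G) (hGM : IsSupportedOn 4 6 M G) (t : unitInterval)
      (hGt : form (c t) = G),
      pointOfCoeffs ℂ 4 6 (fun m : DegIndex 4 6 => coeff m.1 (form (c t))) (hJ t) =
        AlgPoints.map (toBase ℂ 4 6 M) (pointOfFormM ℂ 4 6 M hG hGJ hGM) := by
    intro G hG hGJ hGM t hGt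
    rw [map_toBase_pointOfFormM]
    apply coeffVector_injective ℂ 4 6
    rw [coeffVector_pointOfCoeffs]
    funext m
    rw [coeffVector_apply, pointForm_pointOfForm, hGt]
  let γ₀ : Path (AlgPoints.map (toBase ℂ 4 6 M) t₁) (AlgPoints.map (toBase ℂ 4 6 M) t₂) :=
    { toFun := fun t => pointOfCoeffs ℂ 4 6 (fun m : DegIndex 4 6 => coeff m.1 (form (c t))) (hJ t)
      continuous_toFun := hcont
      source' := hends (isHomogeneous_form ψ) (isNonsingularForm_form hψ) (isSupportedOn_form ψ) 0
        (by rw [c.source])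
      target' := hends (isHomogeneous_fermatPolynomial 4 6) isNonsingularForm_fermat isSupportedOn_fermat 1
        (by rw [c.target, form_zero]) }
  have hγ₀ : ∀ u, IsSupportedOn 4 6 M (pointForm ℂ 4 6 (γ₀ u)) := fun u => by
    change IsSupportedOn 4 6 M (pointForm ℂ 4 6 (pointOfCoeffs ℂ 4 6 _ (hJ u)))
    rw [pointForm_pointOfCoeffs, formOfCoeffs_coeff _ (isHomogeneous_form (c u))]
    exact isSupportedOn_form (c u)
  obtain ⟨γ', -⟩ := exists_path_lift_toBase ℂ 4 6 M γ₀ hγ₀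
  let s₁ : (Set.univ : Set (ComplexPoints (baseM ℂ 4 6 M))) := ⟨t₁, trivial⟩
  let s₂ : (Set.univ : Set (ComplexPoints (baseM ℂ 4 6 M))) := ⟨t₂, trivial⟩
  let γ'' : Path s₁ s₂ :=
    { toFun := fun u => ⟨γ' u, trivial⟩
      continuous_toFun := γ'.continuous.subtype_mk _
      source' := Subtype.ext γ'.source
      target' := Subtype.ext γ'.target }
  obtain ⟨e₁, he₁⟩ := exists_fiberIso_of_eq' t₁ (pointFormM_pointOfFormM ℂ 4 6 M _ _ _)
  obtain ⟨e₂, he₂⟩ := exists_fiberIso_of_eq' t₂ (pointFormM_pointOfFormM ℂ 4 6 M _ _ _)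
  exact exists_transportData_of_family (familyM ℂ 4 6 M)
    (isCohomologicallyLocallyTrivialOn_familyM 4 6 M (by norm_num) (by norm_num)) (s₁ := s₁) (s₂ := s₂) ⟦γ''⟧
    (fun a => sigmaM ℂ 4 6 M (a : Fin (4 + 2) → ℂˣ) (hfix a)) (fun a => sigmaM_comp_familyM ℂ 4 6 M _ (hfix a))
    (fun a t => sigmaMFiber ℂ 4 6 M (a : Fin (4 + 2) → ℂˣ) (hfix a) t)
    (fun a t => sigmaMFiber_comp_fiberι ℂ 4 6 M _ (hfix a) t) e₁ e₂
    (fun a => sigmaMFiber_comp_eq_diagonalAut 4 6 M _ (hfix a) t₁ e₁ he₁ (gammaW_le_diagonalStabilizer ψ a.2))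
    (fun a => sigmaMFiber_comp_eq_diagonalAut 4 6 M _ (hfix a) t₂ e₂ he₂ (gammaW_le_diagonalStabilizer_fermat a.2))
    (totalMToTotal ℂ 4 6 M ≫ UniversalHypersurface.toProjectiveSpace ℂ 4 6) he₁.symm he₂.symm

/-! ### Purity of the flat pieces `j = 0, 2, 3` modulo the character of `H^{4,0}(X_ψ)` -/

/-- **Katz's Lemma 3.1(2) at `ψ⁶ ≠ 1` for the flat types `(1,2,3,3,4,5)`, `(1,1,2,4,5,5)`,
`(1,1,3,3,5,5)`, granted only the `Γ_W`-character of `H^{4,0}(X_ψ)`**: if every `Γ_W`-eigenclass of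
`H⁴(X_ψ(ℂ); ℂ)` of non-trivial character and of type `(4,0)` in the Hodge model `A` vanishes, then the
`Γ_W`-eigenspaces of `χ_{e∘σ}` and `χ_{(6−e)∘σ}`, `e = flatTypes j`, `j ≠ 1`, pull back into `H^{2,2}_A`
(`flatTypes_pullback_mem_hodgePQ_two_two_of_transport` fed with `exists_transportData`).
[cite: Katz2009, Lemma 3.1(2)] [cite: VoisinHodgeI2002, §6.3.2 Thm. 6.32] -/
theorem flatTypes_pullback_mem_hodgePQ_two_two_of_topCharacter (hψ : ψ ^ 6 ≠ 1) (j : Fin 4) (hj : j ≠ 1)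
    (σ : Equiv.Perm (Fin 6)) (A : HodgeModel 4 (fibre ψ))
    (hZ : ∀ θ : gammaW →* ℂˣ, θ ≠ 1 → ∀ x ∈ diagonalCharacterEigenspace (form ψ) gammaW θ (2 * 2),
      A.pullback (2 * 2) x ∈ A.hodgePQ (2 * 2) 4 0 → x = 0) :
    (∀ c ∈ diagonalCharacterEigenspace (form ψ) gammaW (character fun l => flatTypes j (σ l)) (2 * 2),
        A.pullback (2 * 2) c ∈ A.hodgePQ (2 * 2) 2 2) ∧
    (∀ c ∈ diagonalCharacterEigenspace (form ψ) gammaW (character fun l => 6 - flatTypes j (σ l)) (2 * 2),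
        A.pullback (2 * 2) c ∈ A.hodgePQ (2 * 2) 2 2) := by
  obtain ⟨T, T', hTinj, hTeq, hTconj, hT', hTamb⟩ := exists_transportData hψ
  exact flatTypes_pullback_mem_hodgePQ_two_two_of_transport hψ j hj σ A hZ T hTinj hTeq hTconj T' hT' hTamb

/-- **Crux K2 for the types `(1,2,3,3,4,5)`, `(1,1,2,4,5,5)`, `(1,1,3,3,5,5)`, granted only the
`Γ_W`-character of `H^{4,0}(X_ψ)`**: for `ψ⁶ ≠ 1`, `j ≠ 1`, `σ ∈ 𝔖₆`, if the `Γ_W`-eigenclasses of non-trivial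
character and type `(4,0)` vanish in every Hodge model of `X_ψ`, then every RATIONAL class `w = u + v` with
`u` an eigenclass of exponent `e ∘ σ` and `v` one of exponent `(6 − e) ∘ σ`, `e = flatTypes j`, lies in the
`ℂ`-span of the rational `(2,2)`-classes fixed by a realised reflection `s_(i,i',ζ)`
(`flatClasses_mem_span_reflInvariant_of_transport` fed with `exists_transportData`). Compare
`flatClasses_mem_span_reflInvariant_singleton` (`j = 0`, no hypothesis) and `…_of_griffiths` (all `j`, modulo
Griffiths' residue theorem at pole order two). [cite: Katz2009, Lemma 3.1 and §2 pp. 5–7]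
[cite: BiniGarbagnati2012, §3.4] -/
theorem flatClasses_mem_span_reflInvariant_of_topCharacter (hψ : ψ ^ 6 ≠ 1) (j : Fin 4) (hj : j ≠ 1)
    (σ : Equiv.Perm (Fin 6))
    (hZ : ∀ (A : HodgeModel 4 (fibre ψ)) (θ : gammaW →* ℂˣ), θ ≠ 1 →
      ∀ x ∈ diagonalCharacterEigenspace (form ψ) gammaW θ (2 * 2),
        A.pullback (2 * 2) x ∈ A.hodgePQ (2 * 2) 4 0 → x = 0)
    (w : complexBetti (fibre ψ) (2 * 2)) (hrat : IsRationalClass w)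
    (huv : ∃ u v : complexBetti (fibre ψ) (2 * 2), IsEig ψ (fun l => flatTypes j (σ l)) u ∧
      IsEig ψ (fun l => 6 - flatTypes j (σ l)) v ∧ w = u + v) :
    w ∈ Submodule.span ℂ {c : complexBetti (fibre ψ) (2 * 2) | IsRationalClass c ∧
      IsOfHodgeType 4 (fibre ψ) (2 * 2) 2 2 c ∧ ∃ i i' : Fin 6, i ≠ i' ∧ ∃ ζ : ℂ, ζ ^ 6 = 1 ∧
        ∃ g : C(Motives.ComplexPoints (fibre ψ), Motives.ComplexPoints (fibre ψ)),
          (∀ x, ∃ t : ℂ, (pt ψ (g x)).rep = t • (fun k => if k = i then ζ * (pt ψ x).rep i'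
            else if k = i' then ζ⁻¹ * (pt ψ x).rep i else (pt ψ x).rep k)) ∧
          singularCohomology.map ℂ ℂ g (2 * 2) c = c} := by
  obtain ⟨T, T', hTinj, hTeq, hTconj, hT', hTamb⟩ := exists_transportData hψ
  exact flatClasses_mem_span_reflInvariant_of_transport hψ j hj σ hZ T hTinj hTeq hTconj T' hT' hTamb w hrat huv

end Literature.AlgebraicGeometry.HodgeTheory.DworkSextic

end
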